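import Summits.QuantumFields.YangMills.Theorems.SwapVirialDeficitSectorLaplaceBTubeCapHubCot
import HarnessLib

/-!
# STUB (S-B) OF SKELETON ➎ v9, part 1: THE THRESHOLD ARITHMETIC of `stub_B_stiff` modulo the far floor
# (free-hands support of ⟨stmt-QuantumFields-24197⟩ `SwapVirialDeficit.SwapGluedStiffness` ∕ ⟨24194⟩; cell ym-idea-1, LEAD g99 ruling 2026-08-31 21:25Z (b), assembler fcl-p3 g48)

w2 g59's ✓`bTubeCap_stiff_of_farFloor` is the capped B-tube stiffness for ONE good sign pattern at fixed `L, τ, R, b`, against `μ_B` on the capped region `RgCap`,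
under explicit hypotheses `hR hRX hRτ hsmall hDR hb1 hrate habs` and the FAR FLOOR `hfar` (w3 g67).  This file is the scalar arithmetic that discharges `hb1`, `hrate`, `habs`
from the stub's threshold `K·L^k·τ⁻¹^k ≤ b` (part 2 = ✓`…BTubeCapStiffAssembly`: the reading on `chartMeasure L`, the sign sum, the stub):

* §1 `lambdaB_inv_le` (`λ_B⁻¹ ≤ 15469·L¹⁰·τ⁻¹²`), `finrankB_add_eight_le` (`m_B + 8 ≤ 25L⁴`), `finrankB_div_two_facts`, `mZero_floor`
  (`M₀∕U₀ ≥ e^{−(6 + |log(coneConst³∕64)| + 18L⁴ + 719712L⁸)}`), ★ `bTube_threshold_arith` (ONE master quantity `G ≥ 1, λ_B⁻¹, m_B+8, A₃, R⁻¹, bracket`: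
  `b ≥ (60000L⁴·290G⁵)⁴ ⟹ hb1 ∧ hrate ∧ the exp_absorb bracket`), `bTube_threshold_monomial` (that threshold is `≤ K·L^k·τ⁻¹^k`, `k = 4(4+5(18+k_R))`);
* §2 ★ `bTube_habs` — `habs` from the bracket by ✓`exp_absorb` (`E = 9L⁴ ≥ m_B∕2`).

HONEST LABEL: scalar bookkeeping; (S-B) is closed only MODULO the far floor (w3 g67, OPEN) in part 2; (S-core-tip) [w2 g60], (S-core-end) [LEAD g99], (S-001-good) OPEN;
⟨24197⟩ ∕ ⟨24194⟩ OPEN; item of record ⟨24085⟩ SubOctaveBounded aside ∕ untouched; the Yang–Mills mass gap is NOT proved; no summit is proved by a line.  THEOREMS ONLY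
(0 `def`, 0 `sorry`, no instance attribute), standard axioms.
Seat ym-line-fcl-p3 g48 (cell ym-idea-1, free hands), `--supports stmt-QuantumFields-24197`.  References: [cite: Luscher1983, §2]; [folklore].
-/

set_option autoImplicit false
set_option synthInstance.maxSize 1024

noncomputable section

open MeasureTheory Quaternion Set
open scoped Quaternion BigOperators ENNReal
open Literature.MathematicalPhysics.QuantumLattice
open Literature.MathematicalPhysics.QuantumFieldTheory hiding SU2
open Summit.QuantumFields.YangMills.Theorems.SwapTwistDeficit.ToronLog

namespace Summit.QuantumFields.YangMills.Theorems.SwapVirialDeficit.SectorLaplace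

open Summit.QuantumFields.YangMills.Theorems.FemtoTransferGap
open Summit.QuantumFields.YangMills.Theorems.FemtoTransferGap.TT
open Summit.QuantumFields.YangMills.Theorems.VirialFluxGap.RingDeficit
open Summit.QuantumFields.YangMills.Theorems.SwapVirialDeficit.SwapRing
open Summit.QuantumFields.YangMills.Theorems.SwapVirialDeficit.BlowUpRing

variable {L : ℕ} [NeZero L]

/-! ## §1 Threshold arithmetic -/

omit [NeZero L] in
/-- `λ_B⁻¹ = (1+τ²)·12375L¹⁰∕τ² ≤ 15469·L¹⁰·τ⁻¹²` for `0 < τ ≤ ½`. [folklore] -/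
theorem lambdaB_inv_le {τ : ℝ} (hτ : 0 < τ) (hτ2 : τ ≤ 1 / 2) :
    (τ ^ 2 / ((1 + τ ^ 2) * (12375 * (L : ℝ) ^ 10)))⁻¹ ≤ 15469 * (L : ℝ) ^ 10 * τ⁻¹ ^ 2 := by
  have hτ2' : τ ^ 2 ≤ 1 / 4 := by nlinarith
  have hL : (0 : ℝ) ≤ (L : ℝ) ^ 10 := by positivity
  rw [inv_div, inv_pow, div_eq_mul_inv]
  have h1 : (1 + τ ^ 2) * (12375 * (L : ℝ) ^ 10) ≤ 15469 * (L : ℝ) ^ 10 := by nlinarith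
  exact mul_le_mul_of_nonneg_right h1 (by positivity)

/-- `m_B + 8 = 18L⁴ + 7 ≤ 25L⁴`. [folklore] -/
theorem finrankB_add_eight_le : (Module.finrank ℝ (GnoFibreB L) : ℝ) + 8 ≤ 25 * (L : ℝ) ^ 4 := by
  have h := finrank_gnoFibreB_real_div_two (L := L)
  have hL1 : (1 : ℝ) ≤ L := by exact_mod_cast NeZero.one_le
  have hL4 : (1 : ℝ) ≤ (L : ℝ) ^ 4 := one_le_pow₀ hL1
  linarith

/-- `m_B∕2 ≤ 9L⁴` and `0 ≤ m_B∕2`. [folklore] -/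
theorem finrankB_div_two_facts : 0 ≤ (Module.finrank ℝ (GnoFibreB L) : ℝ) / 2 ∧ (Module.finrank ℝ (GnoFibreB L) : ℝ) / 2 ≤ 9 * (L : ℝ) ^ 4 := by
  have h := finrank_gnoFibreB_real_div_two (L := L)
  have hL1 : (1 : ℝ) ≤ L := by exact_mod_cast NeZero.one_le
  have hL4 : (1 : ℝ) ≤ (L : ℝ) ^ 4 := one_le_pow₀ hL1
  constructor <;> linarith

/-- THE FLOOR OF THE MAIN-TERM RATIO: `e^{−(6 + |log(coneConst³∕64)| + 18L⁴ + 719712L⁸)} ≤ M₀∕U₀` with `M₀ = (4∕81)∕√((39984L⁴)^{m_B})`,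
`U₀ = π·e^{|log(coneConst³∕64)| + 18L⁴}` (`m_B ≤ 18L⁴`, `log(39984L⁴) ≤ 39984L⁴`, `√x ≤ x` for `x ≥ 1`, `π ≤ e²`, `e^{−4} ≤ 4∕81`). [folklore] -/
theorem mZero_floor :
    Real.exp (-(6 + |Real.log (coneConst ^ 3 / 64)| + 18 * (L : ℝ) ^ 4 + 719712 * (L : ℝ) ^ 8)) ≤
      ((4 / 81) / Real.sqrt ((39984 * (L : ℝ) ^ 4) ^ Module.finrank ℝ (GnoFibreB L))) /
        (Real.pi * Real.exp (|Real.log (coneConst ^ 3 / 64)| + 18 * (L : ℝ) ^ 4)) := by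
  have hL1 : (1 : ℝ) ≤ L := by exact_mod_cast NeZero.one_le
  have hL4 : (1 : ℝ) ≤ (L : ℝ) ^ 4 := one_le_pow₀ hL1
  set n : ℕ := Module.finrank ℝ (GnoFibreB L) with hn
  set c₀ : ℝ := |Real.log (coneConst ^ 3 / 64)| with hc₀
  have hn18 : (n : ℝ) ≤ 18 * (L : ℝ) ^ 4 := by
    have h := finrank_gnoFibreB_real_div_two (L := L)
    rw [← hn] at h; linarith
  have hx1 : (1 : ℝ) ≤ 39984 * (L : ℝ) ^ 4 := by linarith
  have hx0 : (0 : ℝ) < 39984 * (L : ℝ) ^ 4 := by linarith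
  -- `(39984L⁴)^n ≤ e^{719712 L⁸}`
  have hpow : (39984 * (L : ℝ) ^ 4) ^ n ≤ Real.exp (719712 * (L : ℝ) ^ 8) := by
    have hlog : Real.log (39984 * (L : ℝ) ^ 4) ≤ 39984 * (L : ℝ) ^ 4 := (Real.log_le_sub_one_of_pos hx0).trans (by linarith)
    have hlog0 : 0 ≤ Real.log (39984 * (L : ℝ) ^ 4) := Real.log_nonneg hx1
    have e1 : (39984 * (L : ℝ) ^ 4) ^ n = Real.exp ((n : ℝ) * Real.log (39984 * (L : ℝ) ^ 4)) := by
      rw [← Real.rpow_natCast, Real.rpow_def_of_pos hx0, mul_comm]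
    rw [e1, Real.exp_le_exp]
    calc (n : ℝ) * Real.log (39984 * (L : ℝ) ^ 4) ≤ (18 * (L : ℝ) ^ 4) * (39984 * (L : ℝ) ^ 4) :=
          mul_le_mul hn18 hlog hlog0 (by positivity)
      _ = 719712 * (L : ℝ) ^ 8 := by ring
  have hpow1 : (1 : ℝ) ≤ (39984 * (L : ℝ) ^ 4) ^ n := one_le_pow₀ hx1
  -- `√x ≤ x` for `x ≥ 1`
  have hsqrt : Real.sqrt ((39984 * (L : ℝ) ^ 4) ^ n) ≤ (39984 * (L : ℝ) ^ 4) ^ n := by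
    rw [Real.sqrt_le_left (by positivity)]
    nlinarith
  have hsqrt0 : 0 < Real.sqrt ((39984 * (L : ℝ) ^ 4) ^ n) := Real.sqrt_pos.2 (by positivity)
  have hU0 : 0 < Real.pi * Real.exp (c₀ + 18 * (L : ℝ) ^ 4) := by positivity
  rw [le_div_iff₀ hU0]
  -- `π ≤ e²`, `e^{-4} ≤ 4/81`
  have h27 : (2.7 : ℝ) ≤ Real.exp 1 := by linarith [Real.exp_one_gt_d9]
  have hpi : Real.pi ≤ Real.exp 2 := by
    have h1 : Real.exp 1 ^ 2 = Real.exp 2 := by rw [Real.exp_one_pow]; norm_num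
    have h2 : (2.7 : ℝ) ^ 2 ≤ Real.exp 1 ^ 2 := pow_le_pow_left₀ (by norm_num) h27 2
    rw [← h1]; linarith [Real.pi_le_four, h2]
  have h481 : Real.exp (-4) ≤ 4 / 81 := by
    have h1 : Real.exp 1 ^ 4 = Real.exp 4 := by rw [Real.exp_one_pow]; norm_num
    have h2 : (2.7 : ℝ) ^ 4 ≤ Real.exp 1 ^ 4 := pow_le_pow_left₀ (by norm_num) h27 4
    have h3 : (81 / 4 : ℝ) ≤ Real.exp 4 := by rw [← h1]; norm_num at h2 ⊢; linarith
    rw [Real.exp_neg, inv_le_comm₀ (Real.exp_pos _) (by norm_num)]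
    rw [show ((4 : ℝ) / 81)⁻¹ = 81 / 4 by norm_num]; exact h3
  -- assemble: LHS·U₀ ≤ e^{−4}·e^{−719712L⁸} ≤ (4/81)/√(...)
  have hM0 : Real.exp (-4) * Real.exp (-(719712 * (L : ℝ) ^ 8)) ≤ (4 / 81) / Real.sqrt ((39984 * (L : ℝ) ^ 4) ^ n) := by
    rw [le_div_iff₀ hsqrt0]
    have h2 : Real.exp (-(719712 * (L : ℝ) ^ 8)) * Real.sqrt ((39984 * (L : ℝ) ^ 4) ^ n) ≤ 1 := by
      calc Real.exp (-(719712 * (L : ℝ) ^ 8)) * Real.sqrt ((39984 * (L : ℝ) ^ 4) ^ n)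
          ≤ Real.exp (-(719712 * (L : ℝ) ^ 8)) * Real.exp (719712 * (L : ℝ) ^ 8) :=
            mul_le_mul_of_nonneg_left (hsqrt.trans hpow) (Real.exp_pos _).le
        _ = 1 := by rw [← Real.exp_add]; simp
    calc Real.exp (-4) * Real.exp (-(719712 * (L : ℝ) ^ 8)) * Real.sqrt ((39984 * (L : ℝ) ^ 4) ^ n)
        = Real.exp (-4) * (Real.exp (-(719712 * (L : ℝ) ^ 8)) * Real.sqrt ((39984 * (L : ℝ) ^ 4) ^ n)) := by ring
      _ ≤ (4 / 81) * 1 := mul_le_mul h481 h2 (by positivity) (by norm_num)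
      _ = 4 / 81 := mul_one _
  calc Real.exp (-(6 + c₀ + 18 * (L : ℝ) ^ 4 + 719712 * (L : ℝ) ^ 8)) * (Real.pi * Real.exp (c₀ + 18 * (L : ℝ) ^ 4))
      ≤ Real.exp (-(6 + c₀ + 18 * (L : ℝ) ^ 4 + 719712 * (L : ℝ) ^ 8)) * (Real.exp 2 * Real.exp (c₀ + 18 * (L : ℝ) ^ 4)) :=
        mul_le_mul_of_nonneg_left (mul_le_mul_of_nonneg_right hpi (Real.exp_pos _).le) (Real.exp_pos _).le
    _ = Real.exp (-4) * Real.exp (-(719712 * (L : ℝ) ^ 8)) := by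
        rw [← Real.exp_add, ← Real.exp_add, ← Real.exp_add]; congr 1; ring
    _ ≤ (4 / 81) / Real.sqrt ((39984 * (L : ℝ) ^ 4) ^ n) := hM0

omit [NeZero L] in
/-- ★ **THE THRESHOLD ARITHMETIC OF THE B-TUBE LAW**: with ONE master quantity `G ≥ 1` dominating `λ⁻¹`, `m₈ = m_B + 8`, the cubic constant `A`, `R⁻¹` (`R ≤ 1`) and the absorption
bracket `Br`, the threshold `(60000·L₄·290G⁵)⁴ ≤ b` (`L₄ ≥ 1`) gives `1 ≤ b`, the rate condition `hrate` of ✓`bTubeCap_stiff_of_farFloor` with right side `1∕(20000L₄)`, and the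
bracket condition `t^{1∕4}·Br ≤ t·(λR²)` of ✓`exp_absorb` for every `t ≥ b`. [folklore] -/
theorem bTube_threshold_arith {L4 lam m8 A R Br G b : ℝ} (hL4 : 1 ≤ L4) (hG1 : 1 ≤ G) (hlam : 0 < lam) (hlamG : lam⁻¹ ≤ G)
    (hm8 : 0 < m8) (hm8G : m8 ≤ G) (hA : 0 ≤ A) (hAG : A ≤ G) (hR : 0 < R) (hR1 : R ≤ 1) (hRG : R⁻¹ ≤ G) (hBrG : Br ≤ G)
    (hb : (60000 * L4 * (290 * G ^ 5)) ^ 4 ≤ b) :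
    1 ≤ b ∧
      (16 * A * m8 / lam + 256 * A * m8 ^ 2 / lam ^ 2 + 2 * R + 8 * (2 * R) * m8 / lam) / Real.sqrt b + 16 * m8 / (lam * R ^ 2) / b + b ^ (-(1 / 4 : ℝ)) ≤
        1 / (20000 * L4) ∧
      ∀ t : ℝ, b ≤ t → t ^ (1 / 4 : ℝ) * Br ≤ t * (lam * R ^ 2) := by
  -- names
  obtain ⟨X, hX⟩ : ∃ X : ℝ, X = 290 * G ^ 5 := ⟨_, rfl⟩
  obtain ⟨H, hH⟩ : ∃ H : ℝ, H = 60000 * L4 * X := ⟨_, rfl⟩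
  rw [← hX, ← hH] at hb
  have hL40 : 0 < L4 := by linarith
  have hG0 : 0 < G := by linarith
  have hG2 : 1 ≤ G ^ 2 := one_le_pow₀ hG1
  have hG3 : 1 ≤ G ^ 3 := one_le_pow₀ hG1
  have hG4 : 1 ≤ G ^ 4 := one_le_pow₀ hG1
  have hG5 : 1 ≤ G ^ 5 := one_le_pow₀ hG1
  have hX1 : 290 ≤ X := by rw [hX]; nlinarith
  have hX0 : 0 < X := by linarith
  have hH1 : 60000 * L4 ≤ H := by rw [hH]; nlinarith
  have hH1' : 1 ≤ H := by nlinarith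
  have hH0 : 0 < H := by linarith
  have hb1 : 1 ≤ b := le_trans (one_le_pow₀ hH1') hb
  have hb0 : 0 < b := by linarith
  -- the atoms: `lam⁻¹ ≤ G`, `R⁻¹ ≤ G`
  have hil : lam⁻¹ ≤ G := hlamG
  have hil0 : 0 < lam⁻¹ := inv_pos.2 hlam
  have hiR0 : 0 < R⁻¹ := inv_pos.2 hR
  -- numerator bounds
  have hN1 : 16 * A * m8 / lam + 256 * A * m8 ^ 2 / lam ^ 2 + 2 * R + 8 * (2 * R) * m8 / lam ≤ X := by
    have e1 : 16 * A * m8 / lam = 16 * A * m8 * lam⁻¹ := by rw [div_eq_mul_inv]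
    have e2 : 256 * A * m8 ^ 2 / lam ^ 2 = 256 * A * m8 ^ 2 * lam⁻¹ ^ 2 := by rw [div_eq_mul_inv, inv_pow]
    have e3 : 8 * (2 * R) * m8 / lam = 16 * R * m8 * lam⁻¹ := by rw [div_eq_mul_inv]; ring
    rw [e1, e2, e3, hX]
    have hG35 : G ^ 3 ≤ G ^ 5 := pow_le_pow_right₀ hG1 (by norm_num)
    have hG25 : G ^ 2 ≤ G ^ 5 := pow_le_pow_right₀ hG1 (by norm_num)
    have hG15 : G ≤ G ^ 5 := by
      calc G = G ^ 1 := (pow_one G).symm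
        _ ≤ G ^ 5 := pow_le_pow_right₀ hG1 (by norm_num)
    have t1 : 16 * A * m8 * lam⁻¹ ≤ 16 * G ^ 5 := by
      have h : A * m8 * lam⁻¹ ≤ G * G * G := mul_le_mul (mul_le_mul hAG hm8G hm8.le hG0.le) hil hil0.le (by positivity)
      calc 16 * A * m8 * lam⁻¹ = 16 * (A * m8 * lam⁻¹) := by ring
        _ ≤ 16 * (G * G * G) := mul_le_mul_of_nonneg_left h (by norm_num)
        _ = 16 * G ^ 3 := by ring
        _ ≤ 16 * G ^ 5 := mul_le_mul_of_nonneg_left hG35 (by norm_num)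
    have t2 : 256 * A * m8 ^ 2 * lam⁻¹ ^ 2 ≤ 256 * G ^ 5 := by
      have h1 : m8 ^ 2 ≤ G ^ 2 := pow_le_pow_left₀ hm8.le hm8G 2
      have h2 : lam⁻¹ ^ 2 ≤ G ^ 2 := pow_le_pow_left₀ hil0.le hil 2
      have h : A * m8 ^ 2 * lam⁻¹ ^ 2 ≤ G * G ^ 2 * G ^ 2 := mul_le_mul (mul_le_mul hAG h1 (by positivity) hG0.le) h2 (by positivity) (by positivity)
      calc 256 * A * m8 ^ 2 * lam⁻¹ ^ 2 = 256 * (A * m8 ^ 2 * lam⁻¹ ^ 2) := by ring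
        _ ≤ 256 * (G * G ^ 2 * G ^ 2) := mul_le_mul_of_nonneg_left h (by norm_num)
        _ = 256 * G ^ 5 := by ring
    have t3 : 2 * R ≤ 2 * G ^ 5 := by
      have h : R ≤ G ^ 5 := hR1.trans (hG1.trans hG15)
      linarith
    have t4 : 16 * R * m8 * lam⁻¹ ≤ 16 * G ^ 5 := by
      have h : R * m8 * lam⁻¹ ≤ 1 * G * G := mul_le_mul (mul_le_mul hR1 hm8G hm8.le zero_le_one) hil hil0.le (by positivity)
      calc 16 * R * m8 * lam⁻¹ = 16 * (R * m8 * lam⁻¹) := by ring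
        _ ≤ 16 * (1 * G * G) := mul_le_mul_of_nonneg_left h (by norm_num)
        _ = 16 * G ^ 2 := by ring
        _ ≤ 16 * G ^ 5 := mul_le_mul_of_nonneg_left hG25 (by norm_num)
    linarith
  have hG45 : G * (G * G ^ 2) ≤ 290 * G ^ 5 := by
    have h1 : G * (G * G ^ 2) = G ^ 4 := by ring
    have h2 : G ^ 4 ≤ G ^ 5 := pow_le_pow_right₀ hG1 (by norm_num)
    have h3 : 0 ≤ G ^ 5 := by positivity
    rw [h1]; linarith
  have hN2 : 16 * m8 / (lam * R ^ 2) ≤ X := by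
    rw [div_eq_mul_inv, mul_inv, ← inv_pow, hX]
    have h2 : R⁻¹ ^ 2 ≤ G ^ 2 := pow_le_pow_left₀ hiR0.le hRG 2
    have h : m8 * (lam⁻¹ * R⁻¹ ^ 2) ≤ G * (G * G ^ 2) := mul_le_mul hm8G (mul_le_mul hil h2 (by positivity) hG0.le) (by positivity) hG0.le
    have h4 : G * (G * G ^ 2) = G ^ 4 := by ring
    have h5 : G ^ 4 ≤ G ^ 5 := pow_le_pow_right₀ hG1 (by norm_num)
    calc 16 * m8 * (lam⁻¹ * R⁻¹ ^ 2) = 16 * (m8 * (lam⁻¹ * R⁻¹ ^ 2)) := by ring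
      _ ≤ 16 * G ^ 4 := by rw [← h4]; exact mul_le_mul_of_nonneg_left h (by norm_num)
      _ ≤ 290 * G ^ 5 := by nlinarith [h5, hG4]
  have hBrX : Br / (lam * R ^ 2) ≤ X := by
    rw [div_eq_mul_inv, mul_inv, ← inv_pow, hX]
    have h2 : R⁻¹ ^ 2 ≤ G ^ 2 := pow_le_pow_left₀ hiR0.le hRG 2
    have h : Br * (lam⁻¹ * R⁻¹ ^ 2) ≤ G * (G * G ^ 2) := mul_le_mul hBrG (mul_le_mul hil h2 (by positivity) hG0.le) (by positivity) hG0.le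
    exact h.trans hG45
  -- powers of `b`: `H ≤ b^{1/4}`, `H² ≤ √b`, `H ≤ b`
  have hH4b : H ^ 4 ≤ b := hb
  have hbq : H ≤ b ^ (1 / 4 : ℝ) := by
    have h := Real.rpow_le_rpow (by positivity) hH4b (by norm_num : (0 : ℝ) ≤ 1 / 4)
    have e : (H ^ 4) ^ (1 / 4 : ℝ) = H := by
      rw [← Real.rpow_natCast H 4, ← Real.rpow_mul hH0.le]; norm_num
    rw [e] at h; exact h
  have hbs : H ^ 2 ≤ Real.sqrt b := by
    rw [Real.le_sqrt (by positivity) hb0.le]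
    calc (H ^ 2) ^ 2 = H ^ 4 := by ring
      _ ≤ b := hH4b
  have hHH4 : H ≤ H ^ 4 := by
    calc H = H * 1 := (mul_one H).symm
      _ ≤ H * H ^ 3 := mul_le_mul_of_nonneg_left (one_le_pow₀ hH1') hH0.le
      _ = H ^ 4 := by ring
  have hHb : H ≤ b := hHH4.trans hH4b
  have hH2 : H ≤ H ^ 2 := by
    calc H = H * 1 := (mul_one H).symm
      _ ≤ H * H := mul_le_mul_of_nonneg_left hH1' hH0.le
      _ = H ^ 2 := by ring
  -- the three terms, each `≤ 1/(60000 L4)`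
  have hXH : X / H = 1 / (60000 * L4) := by
    rw [hH]; field_simp
  have hsqrt0 : 0 < Real.sqrt b := Real.sqrt_pos.2 hb0
  have hN1_0 : 0 ≤ 16 * A * m8 / lam + 256 * A * m8 ^ 2 / lam ^ 2 + 2 * R + 8 * (2 * R) * m8 / lam := by positivity
  have term1 : (16 * A * m8 / lam + 256 * A * m8 ^ 2 / lam ^ 2 + 2 * R + 8 * (2 * R) * m8 / lam) / Real.sqrt b ≤ 1 / (60000 * L4) := by
    rw [← hXH]
    calc _ ≤ X / Real.sqrt b := div_le_div_of_nonneg_right hN1 hsqrt0.le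
      _ ≤ X / H := div_le_div_of_nonneg_left hX0.le hH0 (hH2.trans hbs)
  have term2 : 16 * m8 / (lam * R ^ 2) / b ≤ 1 / (60000 * L4) := by
    rw [← hXH]
    calc _ ≤ X / b := div_le_div_of_nonneg_right hN2 hb0.le
      _ ≤ X / H := div_le_div_of_nonneg_left hX0.le hH0 hHb
  have term3 : b ^ (-(1 / 4 : ℝ)) ≤ 1 / (60000 * L4) := by
    rw [Real.rpow_neg hb0.le]
    calc (b ^ (1 / 4 : ℝ))⁻¹ ≤ H⁻¹ := inv_anti₀ hH0 hbq
      _ ≤ (60000 * L4)⁻¹ := inv_anti₀ (by positivity) hH1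
      _ = 1 / (60000 * L4) := (one_div _).symm
  refine ⟨hb1, ?_, fun t hbt => ?_⟩
  · have e : 1 / (20000 * L4) = 1 / (60000 * L4) + 1 / (60000 * L4) + 1 / (60000 * L4) := by
      field_simp; norm_num
    rw [e]; linarith
  · -- bracket: `Br/(lam R²) ≤ X ≤ H ≤ H³ ≤ b^{3/4} ≤ t^{3/4}`
    have ht0 : 0 < t := by linarith
    have hlamR : 0 < lam * R ^ 2 := by positivity
    have hXle : X ≤ H := by
      rw [hH]; nlinarith
    have h34 : H ≤ t ^ (3 / 4 : ℝ) := by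
      have ht4 : H ^ 4 ≤ t := hH4b.trans hbt
      have h := Real.rpow_le_rpow (by positivity) ht4 (by norm_num : (0 : ℝ) ≤ 3 / 4)
      have e : (H ^ 4) ^ (3 / 4 : ℝ) = H ^ 3 := by
        rw [← Real.rpow_natCast H 4, ← Real.rpow_mul hH0.le, show ((4 : ℕ) : ℝ) * (3 / 4 : ℝ) = ((3 : ℕ) : ℝ) by norm_num, Real.rpow_natCast]
      rw [e] at h
      have hHH3 : H ≤ H ^ 3 := by
        calc H = H * 1 := (mul_one H).symm
          _ ≤ H * H ^ 2 := mul_le_mul_of_nonneg_left (one_le_pow₀ hH1') hH0.le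
          _ = H ^ 3 := by ring
      exact hHH3.trans h
    have hkey : Br ≤ t ^ (3 / 4 : ℝ) * (lam * R ^ 2) := by
      have h1 : Br / (lam * R ^ 2) ≤ t ^ (3 / 4 : ℝ) := hBrX.trans (hXle.trans h34)
      rwa [div_le_iff₀ hlamR] at h1
    have et : t = t ^ (1 / 4 : ℝ) * t ^ (3 / 4 : ℝ) := by
      rw [← Real.rpow_add ht0]; norm_num
    calc t ^ (1 / 4 : ℝ) * Br ≤ t ^ (1 / 4 : ℝ) * (t ^ (3 / 4 : ℝ) * (lam * R ^ 2)) :=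
          mul_le_mul_of_nonneg_left hkey (Real.rpow_nonneg ht0.le _)
      _ = t * (lam * R ^ 2) := by rw [← mul_assoc, ← et]

/-! ## §2 The absorption condition `habs` -/

/-- ★ **`habs` FROM THE BRACKET**: if `1 ≤ t` and `t^{1∕4}·(4(9L⁴+1) + (6 + |log(coneConst³∕64)| + 18L⁴ + 719712L⁸)) ≤ t·(λR²)`, then
`e^{−t·λR²}·U₀ ≤ t^{−1∕4}·((2π∕t)^{m_B∕2}·M₀)` (✓`exp_absorb` with `e = m_B∕2 ≤ E = 9L⁴` and `mZero_floor`). [folklore] -/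
theorem bTube_habs {lamR2 t : ℝ} (ht1 : 1 ≤ t)
    (hX : t ^ (1 / 4 : ℝ) * (4 * (9 * (L : ℝ) ^ 4 + 1) + (6 + |Real.log (coneConst ^ 3 / 64)| + 18 * (L : ℝ) ^ 4 + 719712 * (L : ℝ) ^ 8)) ≤ t * lamR2) :
    Real.exp (-(t * lamR2)) * (Real.pi * Real.exp (|Real.log (coneConst ^ 3 / 64)| + 18 * (L : ℝ) ^ 4)) ≤
      t ^ (-(1 / 4 : ℝ)) * ((2 * Real.pi / t) ^ ((Module.finrank ℝ (GnoFibreB L) : ℝ) / 2) *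
        ((4 / 81) / Real.sqrt ((39984 * (L : ℝ) ^ 4) ^ Module.finrank ℝ (GnoFibreB L)))) := by
  obtain ⟨he0, heE⟩ := finrankB_div_two_facts (L := L)
  have hM0 : 0 ≤ 6 + |Real.log (coneConst ^ 3 / 64)| + 18 * (L : ℝ) ^ 4 + 719712 * (L : ℝ) ^ 8 := by positivity
  have hU0 : 0 < Real.pi * Real.exp (|Real.log (coneConst ^ 3 / 64)| + 18 * (L : ℝ) ^ 4) := by positivity
  have h := exp_absorb ht1 he0 heE hM0 (mZero_floor (L := L)) hX
  have ht0 : 0 < t := by linarith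
  calc Real.exp (-(t * lamR2)) * (Real.pi * Real.exp (|Real.log (coneConst ^ 3 / 64)| + 18 * (L : ℝ) ^ 4))
      ≤ t ^ (-(1 / 4 : ℝ)) * ((2 * Real.pi / t) ^ ((Module.finrank ℝ (GnoFibreB L) : ℝ) / 2) *
          (((4 / 81) / Real.sqrt ((39984 * (L : ℝ) ^ 4) ^ Module.finrank ℝ (GnoFibreB L))) /
            (Real.pi * Real.exp (|Real.log (coneConst ^ 3 / 64)| + 18 * (L : ℝ) ^ 4)))) *
          (Real.pi * Real.exp (|Real.log (coneConst ^ 3 / 64)| + 18 * (L : ℝ) ^ 4)) := mul_le_mul_of_nonneg_right h hU0.le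
    _ = _ := by
        rw [mul_assoc, mul_assoc, div_mul_cancel₀ _ hU0.ne']

omit [NeZero L] in
/-- The threshold monomial: with `G = C·L^{18+k_R}·τ⁻¹^{2+k_R}`, `(60000L⁴·290G⁵)⁴ ≤ (60000·290·C⁵)⁴ · L^{4(4+5(18+k_R))} · τ⁻¹^{4(4+5(18+k_R))}` (`L, τ⁻¹ ≥ 1`). [folklore] -/
theorem bTube_threshold_monomial {C Lr ti : ℝ} {kR : ℕ} (hL : 1 ≤ Lr) (hti : 1 ≤ ti) :
    (60000 * Lr ^ 4 * (290 * (C * Lr ^ (18 + kR) * ti ^ (2 + kR)) ^ 5)) ^ 4 ≤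
      (60000 * 290 * C ^ 5) ^ 4 * Lr ^ (4 * (4 + 5 * (18 + kR))) * ti ^ (4 * (4 + 5 * (18 + kR))) := by
  have e : (60000 * Lr ^ 4 * (290 * (C * Lr ^ (18 + kR) * ti ^ (2 + kR)) ^ 5)) ^ 4 =
      (60000 * 290 * C ^ 5) ^ 4 * Lr ^ (4 * (4 + 5 * (18 + kR))) * ti ^ (4 * (5 * (2 + kR))) := by
    have h1 : Lr ^ (4 * 4) * Lr ^ ((18 + kR) * 5 * 4) = Lr ^ (4 * (4 + 5 * (18 + kR))) := by
      rw [← pow_add]; congr 1; ring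
    have h2 : ti ^ ((2 + kR) * 5 * 4) = ti ^ (4 * (5 * (2 + kR))) := by congr 1; ring
    simp only [mul_pow, ← pow_mul]
    rw [← h1, ← h2]; ring
  rw [e]
  have hexp : 4 * (5 * (2 + kR)) ≤ 4 * (4 + 5 * (18 + kR)) := by omega
  exact mul_le_mul_of_nonneg_left (pow_le_pow_right₀ hti hexp) (by positivity)

end Summit.QuantumFields.YangMills.Theorems.SwapVirialDeficit.SectorLaplace

end
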